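import Summits.QuantumFields.YangMills.Theorems.BalabanUVNodesN14ConvexFibreEngine

/-!
# BalabanUVNodes ∕ node N14 = NE1′ — ONE RENORMALISATION STEP IN HERBST CURRENCY: integrating out a fibre that is sub-Gaussian
# UNIFORMLY IN THE BACKGROUND adds the fibre parameter to the dressed observable's sub-Gaussian parameter; for a uniformly convex
# fibre the parameter is (fibre-gradient)²∕λ — the bridge from the convex-fibre engine to the tower, WITHOUT conditional expectations

Cell `pub-ymgap`, HUMAN RULING D-0062 (Track A at full width), seat `pub-ymgap-dag-n14-c` (R134 ACCELERATION, strategy s1), generation 4;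
route `Summits/QuantumFields/YangMills/Theses/BalabanUVNodes.lean` (cluster K3′ `SpineGivenEndpointR12`, `--supports … --as helper`); venue
ruling R424 (`YangMills/Theorems`, namespace `YMDAG.N14.ConvexFibreStep`).  Third file of the convex-fibre engine: `…N14ConvexFibreEngine`
(file A: one uniformly log-concave fibre is sub-Gaussian in GRADIENT currency) and `…N14ConvexFibreWindow` (file B §4: CONDITIONALLY
sub-Gaussian born increments along a filtration ⇒ K-uniform born cumulant) leave one bridge: PRODUCING the conditional statement for one
averaging step from fibrewise convexity.  This file builds it at MEASURE level on `Measure.compProd` (background law `ν` ⊗ fibre kernel `κ`),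
by Fubini, with NO `condExpKernel`.  ADDITIVE — imports file A only (Mathlib's kernel composition comes with it); THEOREMS ONLY (0 `def`).

SETTING.  `ν` a probability law on a measurable BACKGROUND space `B` (the coarser history); `κ : Kernel B E` a Markov FIBRE kernel (the
history-conditioned fluctuation law); the dressed observable `G : B × E → ℝ` measurable with `|G| ≤ B₀`; its FIBRE AVERAGE
`b ↦ ∫ G (b,x) ∂(κ b)` (the observable after the step — written out, no definition); the composite law `ν ⊗ₘ κ` on `B × E`.

WHAT THIS IS.
* §1 THE STEP [folklore, Fubini]: `measurable_fibreAvg`, `abs_fibreAvg_le`, `integral_compProd_eq_integral_fibreAvg` (`∫ G d(ν ⊗ₘ κ) = ∫ (fibre average) dν`);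
  **`hasSubgaussianMGF_compProd_of_fibre`** — if the fibre average is sub-Gaussian about its mean with parameter `c` under `ν`, and EVERY
  fibre is sub-Gaussian about its own average with ONE parameter `c_F` (`∀ b t, ∫ e^{t(G(b,·) − avg b)} ∂(κ b) ≤ e^{c_F t²∕2}` — uniform in the
  background), then `G` is sub-Gaussian about its mean under `ν ⊗ₘ κ` with parameter `c + c_F`: ONE STEP ADDS THE FIBRE PARAMETER;
  `bornCumulant_compProd_le` (the born cumulant `cgf G (ν ⊗ₘ κ) t − t·∫G ≤ (c + c_F)·t²∕2`).
* §2 THE CONVEX FIBRE [cite: BakryGentilLedoux2014, Prop. 5.4.1 + Cor. 5.7.2 — PROVED in the tree, via file A]: `E = EuclideanSpace ℝ (Fin n)`,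
  `κ b = e^{−V b}dx∕Z_b` with EVERY `V b` continuous and `λ`-uniformly convex (first-order letter), `G (b,·) ∈ C¹` with FIBRE-GRADIENT size
  `‖∂ₓG (b,·)‖ ≤ L` ⇒ the fibre hypothesis holds with `c_F = L²∕λ` UNIFORMLY IN `b` (`fibre_mgf_le_of_uniformlyConvex`), hence
  **`hasSubgaussianMGF_compProd_of_uniformlyConvex`** (parameter `c + L²∕λ`) and **`bornCumulant_step_le_of_uniformlyConvex`**.
* §3 TWO STEPS [folklore]: `hasSubgaussianMGF_two_steps` — §1 iterates: the fibre average of the younger step IS the observable of the older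
  step (`(ν ⊗ₘ κ₁) ⊗ₘ κ₀`, parameters `c + c₁ + c₀`).
* §4 THE K-STEP ARITHMETIC [folklore]: `param_le_of_steps` — parameters obeying `c (k+1) ≤ c k + a·θ^{2k}` (`0 ≤ θ < 1`; `a·θ^{2k} =
  (L₀θ^k)²∕λ` is §2's increment when the fibre gradient at depth `k` is `L₀θ^k`, `T4LoopPullback.theta1_exact`'s letter) satisfy
  `c K ≤ c 0 + a∕(1 − θ²)` for EVERY `K` — the K-UNIFORM dressed born cumulant of the tower, iterating §1–§2 step by step.

WHAT THIS IS NOT.  Everything here is PROVED (0 `sorry`, 0 named facts).  In an application the HYPOTHESES are: that Bałaban's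
history-conditioned small-field fluctuation laws ARE such fibre kernels with actions `λ`-uniformly convex UNIFORMLY in the history (NODE O's
located positivity statement; on boxes via the convex-domain port's named facts), and that the pulled-back observable's fibre gradient is
`L₀θ₁^k` at depth `k`.  Nothing of Bałaban's instantiated; N14 NOT discharged; `TiltedMeanMatching` ∕ K3′ NOT instantiated; count-neutral.
One finite four-torus programme at fixed ε; NOT ℝ⁴, NOT OS, NOT a mass gap, NOT Clay.
-/

noncomputable section

namespace YMDAG.N14.ConvexFibreStep

open MeasureTheory ProbabilityTheory Set Filter Topology Finset
open scoped RealInnerProductSpace ENNReal NNReal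
open Literature.Analysis.FunctionSpaces (isProbabilityMeasure_tilted_neg)
open YMDAG.N14.CovGradEngine (bornCumulant_le_of_hasSubgaussianMGF)
open YMDAG.N14.ConvexFibreEngine (hasSubgaussianMGF_of_uniformlyConvex)

/-! ## §1 The step: a background law composed with a uniformly sub-Gaussian fibre kernel -/
section Step

variable {B E : Type*} [MeasurableSpace B] [MeasurableSpace E] {ν : Measure B} [IsProbabilityMeasure ν] {κ : Kernel B E}
  [IsMarkovKernel κ] {G : B × E → ℝ} {B₀ : ℝ}

/-- The fibre average of a bounded measurable observable is measurable in the background. [folklore] -/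
theorem measurable_fibreAvg (hGm : Measurable G) : Measurable fun b => ∫ x, G (b, x) ∂(κ b) :=
  (hGm.stronglyMeasurable.integral_kernel_prod_right' (κ := κ)).measurable

/-- The fibre average is bounded by the observable's bound. [folklore] -/
theorem abs_fibreAvg_le (hGb : ∀ p, |G p| ≤ B₀) (b : B) : |∫ x, G (b, x) ∂(κ b)| ≤ B₀ := by
  have h := norm_integral_le_of_norm_le_const (μ := κ b) (f := fun x => G (b, x)) (C := B₀)
    (Eventually.of_forall fun x => by rw [Real.norm_eq_abs]; exact hGb (b, x))
  rw [Real.norm_eq_abs] at h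
  simpa using h

/-- **FUBINI FOR THE STEP** [folklore]: the composite mean of the observable is the background mean of its fibre average,
`∫ G d(ν ⊗ₘ κ) = ∫ (∫ G (b,x) ∂(κ b)) dν` (Mathlib `Measure.integral_compProd`). -/
theorem integral_compProd_eq_integral_fibreAvg (hGm : Measurable G) (hGb : ∀ p, |G p| ≤ B₀) :
    ∫ p, G p ∂(ν ⊗ₘ κ) = ∫ b, (∫ x, G (b, x) ∂(κ b)) ∂ν :=
  Measure.integral_compProd ((integrable_const B₀).mono' hGm.aestronglyMeasurable
    (Eventually.of_forall fun p => by rw [Real.norm_eq_abs]; exact hGb p))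

/-- **THE STEP — INTEGRATING OUT ONE FIBRE ADDS THE FIBRE PARAMETER** [folklore; the measure-level, Fubini form of Mathlib's
`Kernel.HasSubgaussianMGF.add_compProd`].  Background law `ν`, Markov fibre kernel `κ`, observable `G` measurable with `|G| ≤ B₀`.  If
the FIBRE AVERAGE is sub-Gaussian about its mean with parameter `c` under `ν`, and EVERY fibre law makes `G (b,·)` sub-Gaussian about
its fibre average with ONE parameter `c_F` (uniform in the background `b`), then `G` is sub-Gaussian about its mean under the composite
law `ν ⊗ₘ κ` with parameter `c + c_F`.  (Factorise `e^{t(G − m)} = e^{t(avg b − m)}·e^{t(G − avg b)}`, integrate the fibre first.) -/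
theorem hasSubgaussianMGF_compProd_of_fibre {c cF : ℝ≥0} (hGm : Measurable G) (hGb : ∀ p, |G p| ≤ B₀)
    (hbase : HasSubgaussianMGF (fun b => (∫ x, G (b, x) ∂(κ b)) - ∫ b', (∫ x, G (b', x) ∂(κ b')) ∂ν) c ν)
    (hfib : ∀ (b : B) (t : ℝ), ∫ x, Real.exp (t * (G (b, x) - ∫ y, G (b, y) ∂(κ b))) ∂(κ b) ≤ Real.exp (cF * t ^ 2 / 2)) :
    HasSubgaussianMGF (fun p => G p - ∫ q, G q ∂(ν ⊗ₘ κ)) (c + cF) (ν ⊗ₘ κ) := by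
  set m : ℝ := ∫ q, G q ∂(ν ⊗ₘ κ) with hm
  set avg : B → ℝ := fun b => ∫ x, G (b, x) ∂(κ b) with havg
  have havgm : Measurable avg := measurable_fibreAvg hGm
  have havgb : ∀ b, |avg b| ≤ B₀ := abs_fibreAvg_le hGb
  have hmeq : m = ∫ b, avg b ∂ν := integral_compProd_eq_integral_fibreAvg hGm hGb
  -- the centred observable is bounded by `2B₀`
  have hmb : |m| ≤ B₀ := by
    rw [hmeq, ← Real.norm_eq_abs]
    refine (norm_integral_le_of_norm_le_const (C := B₀) (Eventually.of_forall fun b => ?_)).trans (le_of_eq (by simp))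
    rw [Real.norm_eq_abs]; exact havgb b
  have hcm : Measurable fun p : B × E => G p - m := hGm.sub_const m
  have hcb : ∀ p : B × E, |G p - m| ≤ 2 * B₀ := fun p => by
    have := hGb p
    rw [abs_le] at this hmb ⊢
    constructor <;> linarith [this.1, this.2, hmb.1, hmb.2]
  refine ⟨fun t => ?_, fun t => ?_⟩
  · exact Literature.Probability.Moments.integrable_exp_mul_of_abs_le_const _ hcm hcb t
  · -- Fubini, then the fibre bound, then the base bound
    have hint : Integrable (fun p : B × E => Real.exp (t * (G p - m))) (ν ⊗ₘ κ) :=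
      Literature.Probability.Moments.integrable_exp_mul_of_abs_le_const _ hcm hcb t
    have hfac : ∀ b x, Real.exp (t * (G (b, x) - m)) = Real.exp (t * (avg b - m)) * Real.exp (t * (G (b, x) - avg b)) := fun b x => by
      rw [← Real.exp_add]; congr 1; ring
    -- integrability in `b` of the two bounded factors
    have h1m : Measurable fun b => Real.exp (t * (avg b - m)) := Real.measurable_exp.comp ((havgm.sub_const m).const_mul t)
    have h1b : ∀ b, |Real.exp (t * (avg b - m))| ≤ Real.exp (|t| * (2 * B₀)) := fun b => by
      rw [abs_of_pos (Real.exp_pos _), Real.exp_le_exp]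
      have hb : |avg b - m| ≤ 2 * B₀ := by
        have h1 := havgb b
        rw [abs_le] at h1 hmb ⊢
        constructor <;> linarith [h1.1, h1.2, hmb.1, hmb.2]
      calc t * (avg b - m) ≤ |t * (avg b - m)| := le_abs_self _
        _ = |t| * |avg b - m| := abs_mul _ _
        _ ≤ |t| * (2 * B₀) := mul_le_mul_of_nonneg_left hb (abs_nonneg _)
    have hI1 : Integrable (fun b => Real.exp (t * (avg b - m)) * Real.exp (cF * t ^ 2 / 2)) ν :=
      ((integrable_const (Real.exp (|t| * (2 * B₀)))).mono' h1m.aestronglyMeasurable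
        (Eventually.of_forall fun b => by rw [Real.norm_eq_abs]; exact h1b b)).mul_const _
    calc mgf (fun p => G p - m) (ν ⊗ₘ κ) t
        = ∫ b, ∫ x, Real.exp (t * (G (b, x) - m)) ∂(κ b) ∂ν := by
          rw [mgf]; exact Measure.integral_compProd hint
      _ = ∫ b, Real.exp (t * (avg b - m)) * ∫ x, Real.exp (t * (G (b, x) - avg b)) ∂(κ b) ∂ν := by
          refine integral_congr_ae (Eventually.of_forall fun b => ?_)
          simp only
          rw [← integral_const_mul]
          exact integral_congr_ae (Eventually.of_forall fun x => hfac b x)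
      _ ≤ ∫ b, Real.exp (t * (avg b - m)) * Real.exp (cF * t ^ 2 / 2) ∂ν := by
          refine integral_mono_of_nonneg (Eventually.of_forall fun b => ?_) hI1 (Eventually.of_forall fun b => ?_)
          · exact mul_nonneg (Real.exp_pos _).le (integral_nonneg fun x => (Real.exp_pos _).le)
          · exact mul_le_mul_of_nonneg_left (hfib b t) (Real.exp_pos _).le
      _ = mgf (fun b => avg b - ∫ b', avg b' ∂ν) ν t * Real.exp (cF * t ^ 2 / 2) := by
          rw [integral_mul_const, mgf, ← hmeq]
      _ ≤ Real.exp (c * t ^ 2 / 2) * Real.exp (cF * t ^ 2 / 2) :=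
          mul_le_mul_of_nonneg_right (hbase.mgf_le t) (Real.exp_pos _).le
      _ = Real.exp (↑(c + cF) * t ^ 2 / 2) := by
          rw [← Real.exp_add, NNReal.coe_add]; congr 1; ring

/-- **THE BORN CUMULANT AFTER THE STEP** [folklore]: under the hypotheses of `hasSubgaussianMGF_compProd_of_fibre`,
`cgf G (ν ⊗ₘ κ) t − t·∫G d(ν ⊗ₘ κ) ≤ (c + c_F)·t²∕2` for every real `t` (generation 3's `bornCumulant_le_of_hasSubgaussianMGF`). -/
theorem bornCumulant_compProd_le {c cF : ℝ≥0} (hGm : Measurable G) (hGb : ∀ p, |G p| ≤ B₀)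
    (hbase : HasSubgaussianMGF (fun b => (∫ x, G (b, x) ∂(κ b)) - ∫ b', (∫ x, G (b', x) ∂(κ b')) ∂ν) c ν)
    (hfib : ∀ (b : B) (t : ℝ), ∫ x, Real.exp (t * (G (b, x) - ∫ y, G (b, y) ∂(κ b))) ∂(κ b) ≤ Real.exp (cF * t ^ 2 / 2)) (t : ℝ) :
    cgf G (ν ⊗ₘ κ) t - t * ∫ q, G q ∂(ν ⊗ₘ κ) ≤ ↑(c + cF) * t ^ 2 / 2 :=
  bornCumulant_le_of_hasSubgaussianMGF (hasSubgaussianMGF_compProd_of_fibre hGm hGb hbase hfib) t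

end Step

/-! ## §2 The convex fibre: the fibre parameter is (fibre-gradient)²∕λ, uniformly in the background -/
section Convex

variable {B : Type*} [MeasurableSpace B] {n : ℕ} {ν : Measure B} [IsProbabilityMeasure ν] {κ : Kernel B (EuclideanSpace ℝ (Fin n))}
  [IsMarkovKernel κ] {V G : B × EuclideanSpace ℝ (Fin n) → ℝ} {lam B₀ L : ℝ}

omit [IsMarkovKernel κ] in
/-- **THE FIBRE HYPOTHESIS FROM THE MODULUS, UNIFORMLY IN THE BACKGROUND** [cite: BakryGentilLedoux2014, Prop. 5.4.1 + Cor. 5.7.2 —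
PROVED in the tree; file A's `hasSubgaussianMGF_of_uniformlyConvex` fibre by fibre].  If every fibre law is `κ b = e^{−V(b,·)}dx∕Z_b` with
`V (b,·)` continuous and `λ`-uniformly convex, and `G (b,·) ∈ C¹` with `|G| ≤ B₀` and fibre-gradient size `‖∂ₓG (b,·)‖ ≤ L` (`L > 0`), then
`∫ e^{t(G(b,·) − avg b)} ∂(κ b) ≤ e^{(L²∕λ)·t²∕2}` for EVERY background `b` and real `t`. -/
theorem fibre_mgf_le_of_uniformlyConvex (hlam : 0 < lam)
    (hκ : ∀ b, κ b = (volume : Measure (EuclideanSpace ℝ (Fin n))).tilted fun x => -V (b, x))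
    (hVc : ∀ b, Continuous fun x => V (b, x))
    (hV : ∀ b (x y : EuclideanSpace ℝ (Fin n)),
      V (b, x) + ⟪gradient (fun z => V (b, z)) x, y - x⟫ + lam / 2 * ‖y - x‖ ^ 2 ≤ V (b, y))
    (hZ : ∀ b, Integrable fun x => Real.exp (-V (b, x))) (hG : ∀ b, ContDiff ℝ 1 fun x => G (b, x)) (hGb : ∀ p, |G p| ≤ B₀)
    (hGD : ∀ b x, ‖fderiv ℝ (fun z => G (b, z)) x‖ ≤ L) (hL : 0 < L) (b : B) (t : ℝ) :
    ∫ x, Real.exp (t * (G (b, x) - ∫ y, G (b, y) ∂(κ b))) ∂(κ b) ≤ Real.exp (↑(⟨L ^ 2 / lam, by positivity⟩ : ℝ≥0) * t ^ 2 / 2) := by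
  have h := (hasSubgaussianMGF_of_uniformlyConvex hlam (hVc b) (hV b) (hZ b) (hG b) (fun x => hGb (b, x)) (hGD b) hL).mgf_le t
  rw [hκ b]
  exact h

/-- **ONE RENORMALISATION STEP WITH A UNIFORMLY CONVEX FIBRE** [folklore ∘ the cited, proved facts].  Background law `ν`, fibre kernel
`κ b = e^{−V(b,·)}dx∕Z_b` with every action continuous and `λ`-uniformly convex, observable `G` measurable with `|G| ≤ B₀`, `G (b,·) ∈ C¹`
with fibre gradient `≤ L` (`L > 0`); the fibre average sub-Gaussian about its mean with parameter `c` under `ν`.  Then `G` is sub-Gaussian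
about its mean under `ν ⊗ₘ κ` with parameter `c + L²∕λ`: the step costs (FIBRE GRADIENT)²∕MODULUS — NE1′'s mechanism, since the
pulled-back observable's fibre gradient at depth `k` is `L₀θ₁^k` while the modulus is uniform. -/
theorem hasSubgaussianMGF_compProd_of_uniformlyConvex {c : ℝ≥0} (hlam : 0 < lam)
    (hκ : ∀ b, κ b = (volume : Measure (EuclideanSpace ℝ (Fin n))).tilted fun x => -V (b, x))
    (hVc : ∀ b, Continuous fun x => V (b, x))
    (hV : ∀ b (x y : EuclideanSpace ℝ (Fin n)),
      V (b, x) + ⟪gradient (fun z => V (b, z)) x, y - x⟫ + lam / 2 * ‖y - x‖ ^ 2 ≤ V (b, y))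
    (hZ : ∀ b, Integrable fun x => Real.exp (-V (b, x))) (hGm : Measurable G) (hG : ∀ b, ContDiff ℝ 1 fun x => G (b, x))
    (hGb : ∀ p, |G p| ≤ B₀) (hGD : ∀ b x, ‖fderiv ℝ (fun z => G (b, z)) x‖ ≤ L) (hL : 0 < L)
    (hbase : HasSubgaussianMGF (fun b => (∫ x, G (b, x) ∂(κ b)) - ∫ b', (∫ x, G (b', x) ∂(κ b')) ∂ν) c ν) :
    HasSubgaussianMGF (fun p => G p - ∫ q, G q ∂(ν ⊗ₘ κ)) (c + ⟨L ^ 2 / lam, by positivity⟩) (ν ⊗ₘ κ) :=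
  hasSubgaussianMGF_compProd_of_fibre hGm hGb hbase (fibre_mgf_le_of_uniformlyConvex hlam hκ hVc hV hZ hG hGb hGD hL)

/-- **THE BORN CUMULANT AFTER ONE CONVEX STEP** [folklore]: under the hypotheses of `hasSubgaussianMGF_compProd_of_uniformlyConvex`,
`cgf G (ν ⊗ₘ κ) t − t·∫G d(ν ⊗ₘ κ) ≤ (c + L²∕λ)·t²∕2` for every real `t`. -/
theorem bornCumulant_step_le_of_uniformlyConvex {c : ℝ≥0} (hlam : 0 < lam)
    (hκ : ∀ b, κ b = (volume : Measure (EuclideanSpace ℝ (Fin n))).tilted fun x => -V (b, x))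
    (hVc : ∀ b, Continuous fun x => V (b, x))
    (hV : ∀ b (x y : EuclideanSpace ℝ (Fin n)),
      V (b, x) + ⟪gradient (fun z => V (b, z)) x, y - x⟫ + lam / 2 * ‖y - x‖ ^ 2 ≤ V (b, y))
    (hZ : ∀ b, Integrable fun x => Real.exp (-V (b, x))) (hGm : Measurable G) (hG : ∀ b, ContDiff ℝ 1 fun x => G (b, x))
    (hGb : ∀ p, |G p| ≤ B₀) (hGD : ∀ b x, ‖fderiv ℝ (fun z => G (b, z)) x‖ ≤ L) (hL : 0 < L)
    (hbase : HasSubgaussianMGF (fun b => (∫ x, G (b, x) ∂(κ b)) - ∫ b', (∫ x, G (b', x) ∂(κ b')) ∂ν) c ν) (t : ℝ) :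
    cgf G (ν ⊗ₘ κ) t - t * ∫ q, G q ∂(ν ⊗ₘ κ) ≤ (c + L ^ 2 / lam) * t ^ 2 / 2 := by
  have h := bornCumulant_le_of_hasSubgaussianMGF
    (hasSubgaussianMGF_compProd_of_uniformlyConvex hlam hκ hVc hV hZ hGm hG hGb hGD hL hbase) t
  exact_mod_cast h

end Convex


/-! ## §3 Two steps: the step iterates (the fibre average is the next step's observable) -/
section TwoSteps

variable {B E₁ E₀ : Type*} [MeasurableSpace B] [MeasurableSpace E₁] [MeasurableSpace E₀] {ν : Measure B} [IsProbabilityMeasure ν]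
  {κ₁ : Kernel B E₁} [IsMarkovKernel κ₁] {κ₀ : Kernel (B × E₁) E₀} [IsMarkovKernel κ₀] {G : (B × E₁) × E₀ → ℝ} {B₀ : ℝ}

/-- **TWO STEPS** [folklore]: background `ν`, an older fibre `κ₁` over `B` and a younger fibre `κ₀` over `B × E₁`; observable `G` on
`(B × E₁) × E₀`, measurable with `|G| ≤ B₀`.  If the younger fibres are sub-Gaussian about their averages with ONE `c₀`, the older fibres
make the ONCE-AVERAGED observable `p ↦ ∫ G (p,x) ∂(κ₀ p)` sub-Gaussian about ITS averages with ONE `c₁`, and the twice-averaged observable is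
sub-Gaussian with `c` under `ν`, then `G` is sub-Gaussian about its mean under `(ν ⊗ₘ κ₁) ⊗ₘ κ₀` with parameter `c + c₁ + c₀` — §1 applied
twice, the fibre average of step 0 being the observable of step 1.  (In NE1′'s reading the once-averaged loop has fibre gradient `L₀θ₁`,
the raw loop `L₀`: `c₀ = L₀²∕λ`, `c₁ = (L₀θ₁)²∕λ`.) -/
theorem hasSubgaussianMGF_two_steps {c c₁ c₀ : ℝ≥0} (hGm : Measurable G) (hGb : ∀ p, |G p| ≤ B₀)
    (hfib₀ : ∀ (p : B × E₁) (t : ℝ), ∫ x, Real.exp (t * (G (p, x) - ∫ y, G (p, y) ∂(κ₀ p))) ∂(κ₀ p) ≤ Real.exp (c₀ * t ^ 2 / 2))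
    (hfib₁ : ∀ (b : B) (t : ℝ),
      ∫ z, Real.exp (t * ((∫ x, G ((b, z), x) ∂(κ₀ (b, z))) - ∫ w, (∫ x, G ((b, w), x) ∂(κ₀ (b, w))) ∂(κ₁ b))) ∂(κ₁ b) ≤
        Real.exp (c₁ * t ^ 2 / 2))
    (hbase : HasSubgaussianMGF
      (fun b => (∫ z, (∫ x, G ((b, z), x) ∂(κ₀ (b, z))) ∂(κ₁ b)) - ∫ b', (∫ z, (∫ x, G ((b', z), x) ∂(κ₀ (b', z))) ∂(κ₁ b')) ∂ν) c ν) :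
    HasSubgaussianMGF (fun q => G q - ∫ r, G r ∂((ν ⊗ₘ κ₁) ⊗ₘ κ₀)) (c + c₁ + c₀) ((ν ⊗ₘ κ₁) ⊗ₘ κ₀) := by
  -- step 1: the once-averaged observable on `B × E₁` under `ν ⊗ₘ κ₁`
  have havgm : Measurable fun p : B × E₁ => ∫ x, G (p, x) ∂(κ₀ p) := measurable_fibreAvg hGm
  have havgb : ∀ p : B × E₁, |∫ x, G (p, x) ∂(κ₀ p)| ≤ B₀ := abs_fibreAvg_le hGb
  have h1 : HasSubgaussianMGF (fun p : B × E₁ => (∫ x, G (p, x) ∂(κ₀ p)) - ∫ p', (∫ x, G (p', x) ∂(κ₀ p')) ∂(ν ⊗ₘ κ₁)) (c + c₁)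
      (ν ⊗ₘ κ₁) :=
    hasSubgaussianMGF_compProd_of_fibre (G := fun p : B × E₁ => ∫ x, G (p, x) ∂(κ₀ p)) havgm havgb hbase (fun b t => hfib₁ b t)
  -- step 0: the raw observable on `(B × E₁) × E₀`
  exact hasSubgaussianMGF_compProd_of_fibre hGm hGb h1 hfib₀

end TwoSteps

/-! ## §4 The K-step arithmetic: geometric increments keep the parameter K-uniform -/
section Steps

/-- **THE TOWER'S PARAMETER IS K-UNIFORM** [folklore]: if the sub-Gaussian parameters along the steps obey `c (k+1) ≤ c k + a·θ^{2k}`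
(`0 ≤ a`, `0 ≤ θ < 1` — §2's increment `(L₀θ^k)²∕λ` with `a = L₀²∕λ`), then `c K ≤ c 0 + a∕(1 − θ²)` for every `K`. -/
theorem param_le_of_steps {c : ℕ → ℝ} {a θ : ℝ} (ha : 0 ≤ a) (hθ0 : 0 ≤ θ) (hθ : θ < 1)
    (hc : ∀ k, c (k + 1) ≤ c k + a * θ ^ (2 * k)) (K : ℕ) : c K ≤ c 0 + a / (1 - θ ^ 2) := by
  have hθ2 : θ ^ 2 < 1 := by nlinarith
  have hθ20 : 0 ≤ θ ^ 2 := sq_nonneg θ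
  have hsum : Summable fun k : ℕ => a * (θ ^ 2) ^ k := (summable_geometric_of_lt_one hθ20 hθ2).mul_left a
  -- telescoping: `c K ≤ c 0 + Σ_{k<K} a θ^{2k}`
  have htel : ∀ K : ℕ, c K ≤ c 0 + ∑ k ∈ range K, a * (θ ^ 2) ^ k := by
    intro K
    induction K with
    | zero => simp
    | succ K ih =>
        rw [sum_range_succ]
        have h := hc K
        rw [pow_mul] at h
        linarith
  have hgeo : ∑ k ∈ range K, a * (θ ^ 2) ^ k ≤ a / (1 - θ ^ 2) := by
    calc ∑ k ∈ range K, a * (θ ^ 2) ^ k ≤ ∑' k, a * (θ ^ 2) ^ k := hsum.sum_le_tsum (range K) (fun k _ => by positivity)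
      _ = a / (1 - θ ^ 2) := by rw [tsum_mul_left, tsum_geometric_of_lt_one hθ20 hθ2, div_eq_mul_inv]
  exact (htel K).trans (by linarith)

end Steps

end YMDAG.N14.ConvexFibreStep

end
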